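import Mathlib
import Summits.AnomalousDissipation.AnomalousDissipation.Theorems.SoloBlindLiftoffNextOrder

/-!
# Lift-off junction = Hastings–McLeod Painlevé II — kernel #117 (solo-blind s65)

In the sub-layer `η - 1 = ε^{1/3} ξ`, `α = ε^{1/6} A(ξ)`, `m = 6 + ε^{1/3} M(ξ)` of the lift-off
inner problem `ε α'' + w α = 0`, `m - m''' = (α²)'''` (`w = (m-6)/6` to leading order) the
leading balance is `A'' + (M/6) A = 0`, `M = 6ξ - A²`, i.e. `A'' + (ξ - A²/6) A = 0` with
`A → 0` (`ξ → -∞`) and `A ∼ √(6ξ)` (`ξ → +∞`).  The substitution `A(ξ) = √12 · u(-ξ)` maps it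
to Painlevé II `u'' = 2u³ + xu` with the Hastings–McLeod boundary behaviour.
This file certifies: the substitution (chain rule through `x = -ξ` and the cubic algebra
`(√12)³/6 = 2√12`); the scaling bookkeeping `ε = δ³`; the far-field consistency of
`A² = 6ξ - (3/2)ξ⁻² + …` (with `B = 6ξ + kξ⁻²` the slow balance holds to `O(ξ⁻⁵)` iff
`k = -3/2`; for `k = -3/2` the exact residual is `-9(8ξ³-1)/(4ξ²(4ξ³-1)²)`, bounded by `2/ξ⁵`
for `ξ ≥ 1`); the Hastings–McLeod coefficient `c = 1/8` from the leading balance and the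
resulting `-(3/2)ξ⁻²`; and the match with the live-side `O(ε)` particular solution
`-(3/2) ε (η-1)⁻²` (`(s⁻²)''' = -24 s⁻⁵` against the forcing `6ε R''' = 36 ε s⁻⁵`).
-/

namespace Summit.AnomalousDissipation.AnomalousDissipation.Theorems

open Real

/-! ## The substitution `A(ξ) = √12 u(-ξ)` -/

/-- chain rule through `x = -ξ`: `(√12·u(-ξ))' = -√12·u'(-ξ)`. -/
theorem hm_sub_hasDerivAt {u u' : ℝ → ℝ} (hu : ∀ x, HasDerivAt u (u' x) x) (ξ : ℝ) :
    HasDerivAt (fun y : ℝ => sqrt 12 * u (-y)) (-(sqrt 12 * u' (-ξ))) ξ := by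
  have h := ((hu (-ξ)).comp ξ (hasDerivAt_neg ξ)).const_mul (sqrt 12)
  have e : sqrt 12 * (u' (-ξ) * -1) = -(sqrt 12 * u' (-ξ)) := by ring
  rw [e] at h
  exact h

/-- second derivative: `(-√12·u'(-ξ))' = √12·u''(-ξ)`. -/
theorem hm_sub_second_hasDerivAt {u' u'' : ℝ → ℝ} (hu' : ∀ x, HasDerivAt u' (u'' x) x) (ξ : ℝ) :
    HasDerivAt (fun y : ℝ => -(sqrt 12 * u' (-y))) (sqrt 12 * u'' (-ξ)) ξ := by
  have h := (((hu' (-ξ)).comp ξ (hasDerivAt_neg ξ)).const_mul (sqrt 12)).neg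
  have e : -(sqrt 12 * (u'' (-ξ) * -1)) = sqrt 12 * u'' (-ξ) := by ring
  rw [e] at h
  exact h

/-- the cubic algebra of the substitution: `√12(2U³ + (-ξ)U) = (√12 U)³/6 - ξ(√12 U)`
(uses `(√12)² = 12`). -/
theorem hm_substitution_algebra (U ξ : ℝ) :
    sqrt 12 * (2 * U ^ 3 + (-ξ) * U) = (sqrt 12 * U) ^ 3 / 6 - ξ * (sqrt 12 * U) := by
  have h12 : sqrt 12 * sqrt 12 = 12 := Real.mul_self_sqrt (by norm_num)
  linear_combination (-(sqrt 12 * U ^ 3 / 6)) * h12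

/-- PAINLEVÉ II ⇒ the sub-layer equation: if `u'' = 2u³ + xu` then `A(ξ) = √12 u(-ξ)`
satisfies `A'' = A³/6 - ξA`, i.e. `A'' + (ξ - A²/6)A = 0`. -/
theorem hm_substitution {u u'' : ℝ → ℝ} (hP : ∀ x, u'' x = 2 * (u x) ^ 3 + x * u x) (ξ : ℝ) :
    sqrt 12 * u'' (-ξ) = (sqrt 12 * u (-ξ)) ^ 3 / 6 - ξ * (sqrt 12 * u (-ξ)) ∧
    sqrt 12 * u'' (-ξ) + (ξ - (sqrt 12 * u (-ξ)) ^ 2 / 6) * (sqrt 12 * u (-ξ)) = 0 := by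
  have h := hm_substitution_algebra (u (-ξ)) ξ
  rw [← hP (-ξ)] at h
  refine ⟨h, ?_⟩
  rw [h]; ring

/-! ## Scaling bookkeeping `ε = δ³` (`δ = ε^{1/3}`, `α = δ^{1/2} A`, `m - 6 = δ M`) -/

/-- (E1): `ε·α'' = ε δ^{1/2} A''/δ²` and `w α = (δM/6) δ^{1/2} A` carry the same power
`δ^{3/2}` exactly when `ε = δ³`. -/
theorem sublayer_scaling_E1 {δ ε : ℝ} (hδ : 0 < δ) (hε : ε = δ ^ 3) :
    ε * sqrt δ / δ ^ 2 = δ * sqrt δ := by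
  subst hε
  have hδ' : δ ≠ 0 := ne_of_gt hδ
  field_simp

/-- (E2): `m''' = δ M'''/δ³` and `(α²)''' = δ (A²)'''/δ³` balance at order `δ⁻²`, three orders
of `δ` above the undifferentiated `m - 6 = δ M`: `δ/δ³ = δ⁻²` and `δ / (δ/δ³) = δ³ = ε`. -/
theorem sublayer_scaling_E2 {δ ε : ℝ} (hδ : 0 < δ) (hε : ε = δ ^ 3) :
    δ / δ ^ 3 = (δ ^ 2)⁻¹ ∧ δ / (δ / δ ^ 3) = ε := by
  subst hε
  have hδ' : δ ≠ 0 := ne_of_gt hδ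
  constructor
  · field_simp
  · field_simp

/-- the match of the sub-layer term `δ·(k ξ⁻²)` (`ξ = s/δ`, `s = η - 1`) with a live-side term
`k ε s⁻²`: `δ · k/(s/δ)² = k δ³/s²`. -/
theorem sublayer_match (k : ℝ) {δ s : ℝ} (hδ : δ ≠ 0) (hs : s ≠ 0) :
    δ * (k / (s / δ) ^ 2) = k * δ ^ 3 / s ^ 2 := by
  field_simp

/-! ## Far field of the Hastings–McLeod branch: `A² = 6ξ - (3/2)ξ⁻² + O(ξ⁻⁵)` -/

/-- `B(ξ) = 6ξ - (3/2)ξ⁻²` in closed rational form: `B = 3(4ξ³-1)/(2ξ²)`. -/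
theorem hmFar_B_closed {ξ : ℝ} (hξ : ξ ≠ 0) :
    6 * ξ - 3 / 2 * (ξ ^ 2)⁻¹ = 3 * (4 * ξ ^ 3 - 1) / (2 * ξ ^ 2) := by
  field_simp
  ring

/-- `B' = 6 + 3ξ⁻³`. -/
theorem hmFar_B_hasDerivAt {ξ : ℝ} (hξ : ξ ≠ 0) :
    HasDerivAt (fun x : ℝ => 6 * x - 3 / 2 * (x ^ 2)⁻¹) (6 + 3 * (ξ ^ 3)⁻¹) ξ := by
  have h1 : HasDerivAt (fun x : ℝ => x ^ 2) (2 * ξ) ξ := by simpa using hasDerivAt_pow 2 ξ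
  have h2 := h1.inv (pow_ne_zero 2 hξ)
  have h3 := ((hasDerivAt_id ξ).const_mul (6 : ℝ)).sub (h2.const_mul (3 / 2 : ℝ))
  have e : (6 : ℝ) * 1 - 3 / 2 * (-(2 * ξ) / (ξ ^ 2) ^ 2) = 6 + 3 * (ξ ^ 3)⁻¹ := by
    field_simp
    ring
  rw [e] at h3
  exact h3

/-- `B'' = -9ξ⁻⁴`. -/
theorem hmFar_B'_hasDerivAt {ξ : ℝ} (hξ : ξ ≠ 0) :
    HasDerivAt (fun x : ℝ => 6 + 3 * (x ^ 3)⁻¹) (-9 * (ξ ^ 4)⁻¹) ξ := by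
  have h1 : HasDerivAt (fun x : ℝ => x ^ 3) (3 * ξ ^ 2) ξ := by simpa using hasDerivAt_pow 3 ξ
  have h2 := h1.inv (pow_ne_zero 3 hξ)
  have h3 := (h2.const_mul (3 : ℝ)).const_add (6 : ℝ)
  have e : (3 : ℝ) * (-(3 * ξ ^ 2) / (ξ ^ 3) ^ 2) = -9 * (ξ ^ 4)⁻¹ := by
    field_simp
    ring
  rw [e] at h3
  exact h3

/-- COEFFICIENT SELECTION: with `B = 6ξ + kξ⁻²`, `A = √B` has `A''/A = -1/(4ξ²) + O(ξ⁻⁵)` and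
`ξ - B/6 = -k/(6ξ²)`, so the slow balance `A''/A + ξ - B/6 = O(ξ⁻⁵)` holds iff `-1/4 - k/6 = 0`,
i.e. `k = -3/2`. -/
theorem hmFar_coefficient (k : ℝ) : (-1 / 4 - k / 6 = 0) ↔ k = -3 / 2 := by
  constructor <;> intro h <;> linarith

/-- EXACT RESIDUAL for `k = -3/2`: with `B = 6ξ - (3/2)ξ⁻²`, `B' = 6 + 3ξ⁻³`, `B'' = -9ξ⁻⁴`,
`(√B)''/√B + (ξ - B/6) = (2BB'' - B'²)/(4B²) + ξ - B/6 = -9(8ξ³-1)/(4ξ²(4ξ³-1)²)`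
(valid where `ξ ≠ 0`, `4ξ³ ≠ 1`; cf. `sqrt_ratio_second_deriv`). -/
theorem hmFar_residual {ξ : ℝ} (hξ : ξ ≠ 0) (hq : 4 * ξ ^ 3 - 1 ≠ 0) :
    (2 * (6 * ξ - 3 / 2 * (ξ ^ 2)⁻¹) * (-9 * (ξ ^ 4)⁻¹) - (6 + 3 * (ξ ^ 3)⁻¹) ^ 2)
        / (4 * (6 * ξ - 3 / 2 * (ξ ^ 2)⁻¹) ^ 2)
      + (ξ - (6 * ξ - 3 / 2 * (ξ ^ 2)⁻¹) / 6)
      = -9 * (8 * ξ ^ 3 - 1) / (4 * ξ ^ 2 * (4 * ξ ^ 3 - 1) ^ 2) := by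
  rw [hmFar_B_closed hξ]
  obtain ⟨q, hqdef⟩ : ∃ q : ℝ, q = 4 * ξ ^ 3 - 1 := ⟨_, rfl⟩
  have hqne : q ≠ 0 := hqdef ▸ hq
  rw [← hqdef]
  have e8 : 8 * ξ ^ 3 - 1 = 2 * q + 1 := by rw [hqdef]; ring
  rw [e8]
  field_simp
  subst hqdef
  ring

/-- RESIDUAL BOUND: `|-9(8ξ³-1)/(4ξ²(4ξ³-1)²)| ≤ 2/ξ⁵` for `ξ ≥ 1` (so the slow balance holds
to `O(ξ⁻⁵)` while its individual terms are `O(ξ⁻²)`). -/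
theorem hmFar_residual_bound {ξ : ℝ} (hξ : 1 ≤ ξ) :
    |-9 * (8 * ξ ^ 3 - 1) / (4 * ξ ^ 2 * (4 * ξ ^ 3 - 1) ^ 2)| ≤ 2 / ξ ^ 5 := by
  have hξ0 : 0 < ξ := by linarith
  have hξ3 : 1 ≤ ξ ^ 3 := one_le_pow₀ hξ
  have hq : 3 * ξ ^ 3 ≤ 4 * ξ ^ 3 - 1 := by linarith
  have hqpos : 0 < 4 * ξ ^ 3 - 1 := by linarith
  have hden : 0 < 4 * ξ ^ 2 * (4 * ξ ^ 3 - 1) ^ 2 := by positivity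
  have hnum : 0 ≤ 9 * (8 * ξ ^ 3 - 1) := by linarith
  have hξ5 : 0 < ξ ^ 5 := by positivity
  rw [show -9 * (8 * ξ ^ 3 - 1) / (4 * ξ ^ 2 * (4 * ξ ^ 3 - 1) ^ 2)
      = -(9 * (8 * ξ ^ 3 - 1) / (4 * ξ ^ 2 * (4 * ξ ^ 3 - 1) ^ 2)) by ring,
    abs_neg, abs_of_nonneg (div_nonneg hnum hden.le), div_le_div_iff₀ hden hξ5]
  have h1 : 9 * (8 * ξ ^ 3 - 1) * ξ ^ 5 ≤ 72 * (ξ ^ 3 * ξ ^ 5) := by nlinarith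
  have h2 : 2 * (4 * ξ ^ 2 * (3 * ξ ^ 3) ^ 2) ≤ 2 * (4 * ξ ^ 2 * (4 * ξ ^ 3 - 1) ^ 2) := by
    have : (3 * ξ ^ 3) ^ 2 ≤ (4 * ξ ^ 3 - 1) ^ 2 := by nlinarith
    nlinarith [sq_nonneg ξ]
  have h3 : 72 * (ξ ^ 3 * ξ ^ 5) = 2 * (4 * ξ ^ 2 * (3 * ξ ^ 3) ^ 2) := by ring
  linarith

/-! ## The Hastings–McLeod coefficient `1/8` and the `-(3/2)ξ⁻²` term -/

/-- leading balance of `u = √(y/2)(1 - c y⁻³)` in `u_yy = u(2u² - y)` (`y = -x → +∞`):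
`-1/4 = -2c`, i.e. `c = 1/8` (Hastings–McLeod: `u ∼ √(-x/2)(1 + x⁻³/8)`). -/
theorem hm_coefficient (c : ℝ) : (-(1 : ℝ) / 4 = -2 * c) ↔ c = 1 / 8 := by
  constructor <;> intro h <;> linarith

/-- squaring the two-term asymptotics: `12·(y/2)(1 - c y⁻³)² = 6y - 12c y⁻² + 6c² y⁻⁵`. -/
theorem hm_square_expand (c : ℝ) {y : ℝ} (hy : y ≠ 0) :
    12 * (y / 2) * (1 - c * (y ^ 3)⁻¹) ^ 2 = 6 * y - 12 * c * (y ^ 2)⁻¹ + 6 * c ^ 2 * (y ^ 5)⁻¹ := by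
  field_simp
  ring

/-- with `c = 1/8`: the `ξ⁻²` coefficient of `A² = 12u²(-ξ)` is `-12c = -3/2`. -/
theorem hm_A2_coefficient : -12 * (1 / 8 : ℝ) = -3 / 2 := by norm_num

/-! ## Match with the live-side `O(ε)` particular solution near the contact -/

/-- `(s⁻²)' = -2 s⁻³`. -/
theorem invSq_hasDerivAt {s : ℝ} (hs : s ≠ 0) :
    HasDerivAt (fun x : ℝ => x ^ (-2 : ℤ)) ((-2 : ℝ) * s ^ (-3 : ℤ)) s := by
  have h := hasDerivAt_zpow (-2 : ℤ) s (Or.inl hs)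
  have e : ((-2 : ℤ) : ℝ) * s ^ ((-2 : ℤ) - 1) = (-2 : ℝ) * s ^ (-3 : ℤ) := by norm_num
  rw [e] at h
  exact h

/-- `(-2 s⁻³)' = 6 s⁻⁴`. -/
theorem invSq_second_hasDerivAt {s : ℝ} (hs : s ≠ 0) :
    HasDerivAt (fun x : ℝ => (-2 : ℝ) * x ^ (-3 : ℤ)) ((6 : ℝ) * s ^ (-4 : ℤ)) s := by
  have h := (hasDerivAt_zpow (-3 : ℤ) s (Or.inl hs)).const_mul (-2 : ℝ)
  have e : (-2 : ℝ) * (((-3 : ℤ) : ℝ) * s ^ ((-3 : ℤ) - 1)) = (6 : ℝ) * s ^ (-4 : ℤ) := by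
    norm_num; ring
  rw [e] at h
  exact h

/-- `(6 s⁻⁴)' = -24 s⁻⁵`: hence `(s⁻²)''' = -24 s⁻⁵`. -/
theorem invSq_third_hasDerivAt {s : ℝ} (hs : s ≠ 0) :
    HasDerivAt (fun x : ℝ => (6 : ℝ) * x ^ (-4 : ℤ)) ((-24 : ℝ) * s ^ (-5 : ℤ)) s := by
  have h := (hasDerivAt_zpow (-4 : ℤ) s (Or.inl hs)).const_mul (6 : ℝ)
  have e : (6 : ℝ) * (((-4 : ℤ) : ℝ) * s ^ ((-4 : ℤ) - 1)) = (-24 : ℝ) * s ^ (-5 : ℤ) := by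
    norm_num; ring
  rw [e] at h
  exact h

/-- the forcing: `R ∼ -(1/4)s⁻²` near the contact has `R''' ∼ -(1/4)(-24)s⁻⁵ = 6 s⁻⁵`, so
`6εR''' = 36 ε s⁻⁵`; a particular solution `c s⁻²` of `P''' = 36 ε s⁻⁵` needs `-24c = 36ε`,
`c = -(3/2)ε` — the same `-(3/2) ε (η-1)⁻²` as the Hastings–McLeod far field. -/
theorem liftoff_near_contact_match (ε : ℝ) :
    6 * ε * (-(1 / 4 : ℝ) * (-24)) = 36 * ε ∧ (∀ c : ℝ, -24 * c = 36 * ε ↔ c = -(3 / 2) * ε) ∧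
    -(3 / 2 : ℝ) = -12 * (1 / 8) := by
  refine ⟨by ring, fun c => ⟨fun h => by linarith, fun h => by subst h; ring⟩, by norm_num⟩

end Summit.AnomalousDissipation.AnomalousDissipation.Theorems
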